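import Mathlib.Topology.UrysohnsLemma
import Literature.AlgebraicTopology.FundamentalGroup.CircleValuedWinding
import HarnessLib

/-!
# The circle-valued collapse of a normal coordinate

Topic `Literature/AlgebraicTopology/FundamentalGroup`; a proved companion of
`CircleValuedWinding.lean` (the winding homomorphism of a map `X → ℝ/ℤ`) and
`CircleValuedWindingCrossing.lean` (a loop crossing the fibre `θ⁻¹(0)` once has winding `±1`),
supplying the map `θ`: the **Pontryagin–Thom collapse to the circle** of a *normal coordinate*
of a closed "hypersurface" `P ⊆ Y` — a continuous real function `K` on an open neighbourhood
`N ⊇ P` with `K = 0` exactly on `P` (the data of the tree's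
`Literature.AlgebraicTopology.SingularHomology.TransverseDiscDatum`, case `k = 1`; its
`NormalCoordinateCollapse.lean` builds the collapse to `ℝ ∪ {∞}`, here we want values in
`ℝ/ℤ` so that the winding homomorphism applies).  Classically (Milnor, *Topology from the
differentiable viewpoint* (1965), §5–§7; Hatcher 2002, Thm. 1.7) this is the map
"height across a bicollar, constant on the rest", dual to `P`.

The construction is an explicit FORMULA in `K` and a cut-off `ρ` (so that it commutes with
restriction to subspaces on the nose, `circleCollapse_comp`), and the cut-off exists in every
normal space (`exists_cutoff_nhdsSet`):

* `clampHalf s = max (-1/2) (min (1/2) s)`;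
* `circleCollapse K ρ y = [clampHalf (K y / ρ y)] ∈ ℝ/ℤ` if `ρ y ≠ 0`, and `[1/2]` if
  `ρ y = 0` (note `[-1/2] = [1/2]`: far from `P`, on either side, the map takes the antipode
  of `0`);
* `continuous_circleCollapse` — it is continuous on all of `Y` as soon as `ρ` is continuous
  with `tsupport ρ ⊆ N`, `K` is continuous on the open set `N`, `K ≠ 0` on `N ∖ P` and `ρ ≠ 0`
  on `P`;
* `circleCollapse_eq_zero_iff` — its fibre over `0 ∈ ℝ/ℤ` is exactly `P`;
* `circleCollapse_eq_of_rho_eq_one` — where `ρ = 1` (near `P`) it is `[clampHalf (K y)]`, so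
  `clampHalf ∘ K` (`= K` where `|K| ≤ 1/2`) is a local real lift with the sign of `K`: this is
  the local lift demanded by `wind_eq_ofAdd_one_of_crossing`;
* `circleCollapse_comp` — `circleCollapse (K ∘ f) (ρ ∘ f) = circleCollapse K ρ ∘ f` (`rfl`):
  the collapse of the restricted coordinate on a subspace is the restriction of the collapse;
* `exists_cutoff_nhdsSet` — in a normal space, for `P` closed inside `N` open there is a
  continuous `ρ : Y → [0, 1]` with `tsupport ρ ⊆ N` and `ρ = 1` on a neighbourhood of `P`
  (Urysohn twice); `exists_circleCollapse` packages the two.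

Everything is proved; the only definitions are the two explicit formulas.  Intended use: the
`π₁`-obstruction to a non-separating reducing curve of a trisection
(`Literature/Topology/FourManifolds/TrisectionFunctorGKPi1Obstruction.lean`), where `P` is a
compressing disc in a handlebody `H_q` with a normal coordinate restricting to a normal
coordinate of the reducing curve in the central surface.

## References

* J. Milnor, *Topology from the differentiable viewpoint*, Univ. Press of Virginia (1965),
  §5 and §7 (the Pontryagin–Thom construction in codimension one).
* A. Hatcher, *Algebraic Topology*, CUP (2002), Thm. 1.7 (p. 29). [HatcherAT2002]
-/

noncomputable section

open scoped Topology
open Set Function Filter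

namespace Literature.AlgebraicTopology.FundamentalGroup

/-! ### The clamp to `[-1/2, 1/2]` -/

/-- The clamp of a real number to the interval `[-1/2, 1/2]`. [folklore] -/
def clampHalf (s : ℝ) : ℝ := max (-2⁻¹) (min 2⁻¹ s)

/-- The clamp is continuous. [folklore] -/
theorem continuous_clampHalf : Continuous clampHalf :=
  continuous_const.max (continuous_const.min continuous_id)

/-- The clamp takes values in `[-1/2, 1/2]`. [folklore] -/
theorem abs_clampHalf_le (s : ℝ) : |clampHalf s| ≤ 2⁻¹ := by
  rw [abs_le]
  refine ⟨le_max_left _ _, max_le (by norm_num) (min_le_left _ _)⟩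

/-- On `[-1/2, 1/2]` the clamp is the identity. [folklore] -/
theorem clampHalf_of_abs_le {s : ℝ} (hs : |s| ≤ 2⁻¹) : clampHalf s = s := by
  rw [abs_le] at hs
  rw [clampHalf, min_eq_right hs.2, max_eq_right hs.1]

/-- Above `1/2` the clamp is `1/2`. [folklore] -/
theorem clampHalf_of_le {s : ℝ} (hs : 2⁻¹ ≤ s) : clampHalf s = 2⁻¹ := by
  rw [clampHalf, min_eq_left hs, max_eq_right (by norm_num)]

/-- Below `-1/2` the clamp is `-1/2`. [folklore] -/
theorem clampHalf_of_le_neg {s : ℝ} (hs : s ≤ -2⁻¹) : clampHalf s = -2⁻¹ := by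
  rw [clampHalf, min_eq_right (hs.trans (by norm_num)), max_eq_left hs]

/-- The clamp vanishes only at `0`. [folklore] -/
theorem clampHalf_eq_zero_iff {s : ℝ} : clampHalf s = 0 ↔ s = 0 := by
  constructor
  · intro h
    rcases le_total 2⁻¹ s with hs | hs
    · rw [clampHalf_of_le hs] at h; norm_num at h
    rcases le_total s (-2⁻¹) with hs' | hs'
    · rw [clampHalf_of_le_neg hs'] at h; norm_num at h
    rwa [clampHalf_of_abs_le (abs_le.2 ⟨hs', hs⟩)] at h
  · rintro rfl
    exact clampHalf_of_abs_le (by norm_num)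

/-- The clamp has the sign of its argument: positive on positives. [folklore] -/
theorem clampHalf_pos {s : ℝ} (hs : 0 < s) : 0 < clampHalf s := by
  rcases le_total 2⁻¹ s with h | h
  · rw [clampHalf_of_le h]; norm_num
  · rwa [clampHalf_of_abs_le (abs_le.2 ⟨by linarith, h⟩)]

/-- The clamp has the sign of its argument: negative on negatives. [folklore] -/
theorem clampHalf_neg {s : ℝ} (hs : s < 0) : clampHalf s < 0 := by
  rcases le_total s (-2⁻¹) with h | h
  · rw [clampHalf_of_le_neg h]; norm_num
  · rwa [clampHalf_of_abs_le (abs_le.2 ⟨h, by linarith⟩)]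

/-- If `|s| ≥ 1/2` the clamp is `±1/2`. [folklore] -/
theorem clampHalf_eq_or_of_le_abs {s : ℝ} (hs : 2⁻¹ ≤ |s|) :
    clampHalf s = 2⁻¹ ∨ clampHalf s = -2⁻¹ := by
  rcases le_abs'.1 hs with h | h
  · exact Or.inr (clampHalf_of_le_neg h)
  · exact Or.inl (clampHalf_of_le h)

/-! ### Two points of `ℝ/ℤ` -/

/-- In `ℝ/ℤ`, `[-1/2] = [1/2]`. [folklore] -/
theorem coe_neg_half_eq_coe_half :
    (((-2⁻¹ : ℝ)) : AddCircle (1 : ℝ)) = (((2⁻¹ : ℝ)) : AddCircle (1 : ℝ)) := by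
  rw [← sub_eq_zero, ← AddCircle.coe_sub, AddCircle.coe_eq_zero_iff]
  exact ⟨-1, by norm_num⟩

/-- In `ℝ/ℤ`, a real number of absolute value `≤ 1/2` projects to `0` only if it is `0`.
[folklore] -/
theorem coe_eq_zero_iff_of_abs_le {s : ℝ} (hs : |s| ≤ 2⁻¹) :
    ((s : ℝ) : AddCircle (1 : ℝ)) = 0 ↔ s = 0 := by
  constructor
  · intro h
    rw [AddCircle.coe_eq_zero_iff] at h
    obtain ⟨n, hn⟩ := h
    rw [zsmul_eq_mul, mul_one] at hn
    rw [← hn] at hs ⊢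
    have h1 : |(n : ℝ)| < 1 := hs.trans_lt (by norm_num)
    have h2 : |n| < 1 := by exact_mod_cast h1
    rw [Int.abs_lt_one_iff.1 h2, Int.cast_zero]
  · rintro rfl
    exact QuotientAddGroup.mk_zero _

/-- In `ℝ/ℤ`, `[1/2] ≠ 0`. [folklore] -/
theorem coe_half_ne_zero : (((2⁻¹ : ℝ)) : AddCircle (1 : ℝ)) ≠ 0 := by
  rw [Ne, coe_eq_zero_iff_of_abs_le (by norm_num)]
  norm_num

/-! ### The collapse -/

section Collapse

variable {Y : Type*}

open Classical in
/-- **The circle-valued collapse of a normal coordinate `K` with cut-off `ρ`**: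
`[clampHalf (K y / ρ y)] ∈ ℝ/ℤ` where `ρ y ≠ 0`, the antipode `[1/2]` of `0` where `ρ y = 0`.
(Milnor 1965, §5–§7: the Pontryagin–Thom construction in codimension one, with values in
`ℝ/ℤ = [-1/2, 1/2]/(-1/2 ∼ 1/2)`.) [folklore] -/
def circleCollapse (K ρ : Y → ℝ) (y : Y) : AddCircle (1 : ℝ) :=
  if ρ y = 0 then (((2⁻¹ : ℝ)) : AddCircle (1 : ℝ))
  else (((clampHalf (K y / ρ y) : ℝ)) : AddCircle (1 : ℝ))

/-- Where the cut-off vanishes the collapse is `[1/2]`. [folklore] -/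
theorem circleCollapse_of_rho_eq_zero {K ρ : Y → ℝ} {y : Y} (h : ρ y = 0) :
    circleCollapse K ρ y = (((2⁻¹ : ℝ)) : AddCircle (1 : ℝ)) := by
  classical
  simp only [circleCollapse, if_pos h]

/-- Where the cut-off does not vanish the collapse is `[clampHalf (K / ρ)]`. [folklore] -/
theorem circleCollapse_of_rho_ne_zero {K ρ : Y → ℝ} {y : Y} (h : ρ y ≠ 0) :
    circleCollapse K ρ y = (((clampHalf (K y / ρ y) : ℝ)) : AddCircle (1 : ℝ)) := by
  classical
  simp only [circleCollapse, if_neg h]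

/-- **Near `P` (where `ρ = 1`) the collapse is `[clampHalf K]`**: `clampHalf ∘ K` is a local
real lift, equal to `K` where `|K| ≤ 1/2`, with the sign of `K`. [folklore] -/
theorem circleCollapse_eq_of_rho_eq_one {K ρ : Y → ℝ} {y : Y} (h : ρ y = 1) :
    circleCollapse K ρ y = (((clampHalf (K y) : ℝ)) : AddCircle (1 : ℝ)) := by
  rw [circleCollapse_of_rho_ne_zero (by rw [h]; exact one_ne_zero), h, div_one]

/-- **Restriction to a subspace**: the collapse of the restricted data is the restriction of
the collapse (definitionally). [folklore] -/
theorem circleCollapse_comp {Y' : Type*} (K ρ : Y → ℝ) (f : Y' → Y) :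
    circleCollapse (K ∘ f) (ρ ∘ f) = circleCollapse K ρ ∘ f := rfl

/-- Far from `P` in the normal direction (`|K| ≥ |ρ|/2`, in particular where `ρ = 0`) the
collapse is the antipode `[1/2]`. [folklore] -/
theorem circleCollapse_eq_half_of_le {K ρ : Y → ℝ} {y : Y} (h : |ρ y| ≤ 2 * |K y|) :
    circleCollapse K ρ y = (((2⁻¹ : ℝ)) : AddCircle (1 : ℝ)) := by
  by_cases hρ : ρ y = 0
  · exact circleCollapse_of_rho_eq_zero hρ
  · rw [circleCollapse_of_rho_ne_zero hρ]
    have habs : 2⁻¹ ≤ |K y / ρ y| := by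
      rw [abs_div, le_div_iff₀ (abs_pos.2 hρ)]
      linarith
    rcases clampHalf_eq_or_of_le_abs habs with h1 | h1
    · rw [h1]
    · rw [h1, coe_neg_half_eq_coe_half]

variable [TopologicalSpace Y]

/-- **Continuity of the collapse.**  Let `N` be open, `K` continuous on `N` and non-zero on
`N ∖ P`, `ρ` continuous with `tsupport ρ ⊆ N` and `ρ ≠ 0` on `P`.  Then `circleCollapse K ρ`
is continuous on all of `Y`: on `{ρ ≠ 0} ⊆ N` it is a continuous formula; off `tsupport ρ` it is
locally constant; and at a point `y₀ ∈ tsupport ρ` with `ρ y₀ = 0` one has `y₀ ∈ N ∖ P`, so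
`|K| > |K y₀|/2 > |ρ|/2` nearby and the collapse is locally the constant `[1/2] = [-1/2]`.
[folklore] -/
theorem continuous_circleCollapse {K ρ : Y → ℝ} {N P : Set Y} (hN : IsOpen N)
    (hK : ContinuousOn K N) (hKne : ∀ y ∈ N, y ∉ P → K y ≠ 0) (hρ : Continuous ρ)
    (hsupp : tsupport ρ ⊆ N) (hρP : ∀ y ∈ P, ρ y ≠ 0) :
    Continuous (circleCollapse K ρ) := by
  have hWN : {y | ρ y ≠ 0} ⊆ N := fun y hy => hsupp (subset_tsupport ρ hy)
  have hWo : IsOpen {y | ρ y ≠ 0} := isOpen_ne_fun hρ continuous_const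
  -- on `{ρ ≠ 0}` the collapse is a continuous formula
  have hformula : ContinuousOn (circleCollapse K ρ) {y | ρ y ≠ 0} := by
    have hc : ContinuousOn (fun y => (((clampHalf (K y / ρ y) : ℝ)) : AddCircle (1 : ℝ)))
        {y | ρ y ≠ 0} := by
      refine (AddCircle.continuous_mk' (1 : ℝ)).comp_continuousOn ?_
      refine continuous_clampHalf.comp_continuousOn ?_
      exact (hK.mono hWN).div hρ.continuousOn fun y hy => hy
    exact hc.congr fun y hy => circleCollapse_of_rho_ne_zero hy
  rw [continuous_iff_continuousAt]
  intro y₀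
  by_cases h0 : ρ y₀ ≠ 0
  · exact hformula.continuousAt (hWo.mem_nhds h0)
  push Not at h0
  by_cases hts : y₀ ∈ tsupport ρ
  · -- `y₀ ∈ N ∖ P`: the collapse is locally the constant `[1/2]`
    have hyN : y₀ ∈ N := hsupp hts
    have hyP : y₀ ∉ P := fun h => hρP y₀ h h0
    have hK0 : K y₀ ≠ 0 := hKne y₀ hyN hyP
    set κ : ℝ := |K y₀| / 2 with hκ
    have hκpos : 0 < κ := by positivity
    -- the neighbourhood where `|K| > κ` and `|ρ| < κ`
    have hU1 : N ∩ (fun y => |K y|) ⁻¹' Ioi κ ∈ 𝓝 y₀ := by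
      refine ((continuous_abs.comp_continuousOn hK).isOpen_inter_preimage hN isOpen_Ioi).mem_nhds
        ⟨hyN, ?_⟩
      change κ < |K y₀|
      linarith [abs_pos.2 hK0]
    have hU2 : (fun y => |ρ y|) ⁻¹' Iio κ ∈ 𝓝 y₀ := by
      refine ((continuous_abs.comp hρ).isOpen_preimage _ isOpen_Iio).mem_nhds ?_
      change |ρ y₀| < κ
      rw [h0, abs_zero]
      exact hκpos
    have hev : ∀ᶠ y in 𝓝 y₀, circleCollapse K ρ y = (((2⁻¹ : ℝ)) : AddCircle (1 : ℝ)) := by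
      filter_upwards [hU1, hU2] with y hy1 hy2
      refine circleCollapse_eq_half_of_le ?_
      have h1 : κ < |K y| := hy1.2
      have h2 : |ρ y| < κ := hy2
      linarith
    exact (continuousAt_const.congr (EventuallyEq.symm hev) :)
  · -- off the support: `ρ = 0` nearby, the collapse is locally `[1/2]`
    have hev : ∀ᶠ y in 𝓝 y₀, circleCollapse K ρ y = (((2⁻¹ : ℝ)) : AddCircle (1 : ℝ)) := by
      have hzero : ∀ᶠ y in 𝓝 y₀, ρ y = 0 := by
        have hopen : IsOpen (tsupport ρ)ᶜ := (isClosed_tsupport ρ).isOpen_compl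
        filter_upwards [hopen.mem_nhds hts] with y hy
        exact image_eq_zero_of_notMem_tsupport hy
      filter_upwards [hzero] with y hy
      exact circleCollapse_of_rho_eq_zero hy
    exact (continuousAt_const.congr (EventuallyEq.symm hev) :)

/-- **The fibre over `0` is exactly `P`.**  With the hypotheses of `continuous_circleCollapse`
and `K = 0` on `P`: `circleCollapse K ρ y = 0 ↔ y ∈ P` (where `ρ = 0` the value is
`[1/2] ≠ 0`; elsewhere `[clampHalf (K/ρ)] = 0` iff `K = 0` iff `y ∈ P`). [folklore] -/
theorem circleCollapse_eq_zero_iff {K ρ : Y → ℝ} {N P : Set Y}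
    (hKne : ∀ y ∈ N, y ∉ P → K y ≠ 0) (hK0 : ∀ y ∈ P, K y = 0)
    (hsupp : tsupport ρ ⊆ N) (hρP : ∀ y ∈ P, ρ y ≠ 0) (y : Y) :
    circleCollapse K ρ y = 0 ↔ y ∈ P := by
  by_cases hρ : ρ y = 0
  · rw [circleCollapse_of_rho_eq_zero hρ]
    constructor
    · exact fun h => absurd h coe_half_ne_zero
    · exact fun h => absurd hρ (hρP y h)
  · rw [circleCollapse_of_rho_ne_zero hρ, coe_eq_zero_iff_of_abs_le (abs_clampHalf_le _),
      clampHalf_eq_zero_iff, div_eq_zero_iff, or_iff_left hρ]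
    have hyN : y ∈ N := hsupp (subset_tsupport ρ hρ)
    constructor
    · intro h
      by_contra hyP
      exact hKne y hyN hyP h
    · exact hK0 y

/-- The collapse as a bundled continuous map (under the hypotheses of
`continuous_circleCollapse`). [folklore] -/
def circleCollapseMap {K ρ : Y → ℝ} {N P : Set Y} (hN : IsOpen N)
    (hK : ContinuousOn K N) (hKne : ∀ y ∈ N, y ∉ P → K y ≠ 0) (hρ : Continuous ρ)
    (hsupp : tsupport ρ ⊆ N) (hρP : ∀ y ∈ P, ρ y ≠ 0) : C(Y, AddCircle (1 : ℝ)) :=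
  ⟨circleCollapse K ρ, continuous_circleCollapse hN hK hKne hρ hsupp hρP⟩

/-- The bundled collapse is the collapse. [folklore] -/
@[simp] theorem circleCollapseMap_apply {K ρ : Y → ℝ} {N P : Set Y} (hN : IsOpen N)
    (hK : ContinuousOn K N) (hKne : ∀ y ∈ N, y ∉ P → K y ≠ 0) (hρ : Continuous ρ)
    (hsupp : tsupport ρ ⊆ N) (hρP : ∀ y ∈ P, ρ y ≠ 0) (y : Y) :
    circleCollapseMap hN hK hKne hρ hsupp hρP y = circleCollapse K ρ y := rfl

/-! ### The cut-off -/

/-- **A cut-off which is `1` near `P` and supported in `N`** (normal space, `P` closed, `N`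
open, `P ⊆ N`): shrink `N` twice (`P ⊆ U ⊆ Ū ⊆ U₂ ⊆ Ū₂ ⊆ N`) and take a Urysohn function
for the closed sets `U₂ᶜ`, `Ū`. [folklore] -/
theorem exists_cutoff_nhdsSet [NormalSpace Y] {P N : Set Y} (hP : IsClosed P) (hN : IsOpen N)
    (hPN : P ⊆ N) :
    ∃ ρ : C(Y, ℝ), tsupport ρ ⊆ N ∧ (∃ U : Set Y, IsOpen U ∧ P ⊆ U ∧ ∀ y ∈ U, ρ y = 1) ∧
      ∀ y, ρ y ∈ Icc (0 : ℝ) 1 := by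
  obtain ⟨U, hUo, hPU, hUN⟩ := normal_exists_closure_subset hP hN hPN
  obtain ⟨U₂, hU₂o, hUU₂, hU₂N⟩ := normal_exists_closure_subset isClosed_closure hN hUN
  obtain ⟨f, hf0, hf1, hf⟩ := exists_continuous_zero_one_of_isClosed (isClosed_compl_iff.2 hU₂o)
    isClosed_closure (disjoint_compl_left_iff_subset.2 hUU₂)
  refine ⟨f, ?_, ⟨U, hUo, hPU, fun y hy => hf1 (subset_closure hy)⟩, hf⟩
  -- `{f ≠ 0} ⊆ U₂`, so `tsupport f ⊆ closure U₂ ⊆ N`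
  refine (closure_mono ?_).trans hU₂N
  intro y hy
  by_contra hyU
  exact hy (hf0 hyU)

/-- **Existence of the circle-valued collapse** (normal space): for `P` closed inside `N` open
and a continuous `K` on `N` vanishing exactly on `P`, there is a continuous `θ : Y → ℝ/ℤ` with
`θ⁻¹(0) = P` which on an open `V`, `P ⊆ V ⊆ N`, is `[clampHalf ∘ K]` — so that `clampHalf ∘ K`
is a real lift of `θ` near `P` with the sign of `K`.  (For restriction-compatible collapses on
several subspaces use the explicit `circleCollapse K ρ` with one cut-off `ρ` and
`circleCollapse_comp`.) [folklore] -/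
theorem exists_circleCollapse [NormalSpace Y] {P N : Set Y} (hP : IsClosed P) (hN : IsOpen N)
    (hPN : P ⊆ N) {K : Y → ℝ} (hK : ContinuousOn K N) (hKne : ∀ y ∈ N, y ∉ P → K y ≠ 0)
    (hK0 : ∀ y ∈ P, K y = 0) :
    ∃ θ : C(Y, AddCircle (1 : ℝ)), (∀ y, θ y = 0 ↔ y ∈ P) ∧
      ∃ V : Set Y, IsOpen V ∧ P ⊆ V ∧ V ⊆ N ∧
        ∀ y ∈ V, θ y = (((clampHalf (K y) : ℝ)) : AddCircle (1 : ℝ)) := by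
  obtain ⟨ρ, hsupp, ⟨U, hUo, hPU, hU1⟩, -⟩ := exists_cutoff_nhdsSet hP hN hPN
  have hρP : ∀ y ∈ P, ρ y ≠ 0 := fun y hy => by rw [hU1 y (hPU hy)]; exact one_ne_zero
  refine ⟨circleCollapseMap hN hK hKne ρ.continuous hsupp hρP, fun y => ?_,
    U ∩ N, hUo.inter hN, subset_inter hPU hPN, inter_subset_right, fun y hy => ?_⟩
  · exact circleCollapse_eq_zero_iff hKne hK0 hsupp hρP y
  · rw [circleCollapseMap_apply]
    exact circleCollapse_eq_of_rho_eq_one (hU1 y hy.1)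

end Collapse

end Literature.AlgebraicTopology.FundamentalGroup

end
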